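import Mathlib.Analysis.SpecialFunctions.Complex.LogBounds
import Mathlib.Analysis.Complex.Exponential
import Mathlib.NumberTheory.Harmonic.ZetaAsymp
import Literature.NumberTheory.LFunctions.KeiperLiPositivityUpTo
import Literature.NumberTheory.LFunctions.SchoenfeldZeroSums
import Summits.RiemannHypothesis.RiemannHypothesis.Theorems.LiCoefficientsDefs
import HarnessLib

/-!
# RiemannHypothesis / LiCoefficients — crux `LiBoxSplit` (RH-FREE given the verified height), part 1: on-line term (L1),
# far pair (L2), box symmetries

Route `RiemannHypothesis/LiCoefficients` (cell `pub/rh-li`, D-0059/D-0061), item `LiBoxSplit` (L5 of the theory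
memo `theory/TARGETS.md` §8.1).  For RH verified to height `T`, `1100 ≤ T₂ ≤ T`, `1 ≤ n ≤ T²/4` and any
bound `B` of the far tails `∑_{T < Im ρ ≤ U} m(ρ)/(Im ρ)⁴` (all `U ≥ T`):

  `λ_n ≥ 2 ∑_{T₂/2 < Im ρ ≤ T₂} m(ρ) f_n(Im ρ) − 2.82 n² B`,   `f_n(t) = 1 − cos(n θ(t))`, `θ(t) = 2 arctan(1/2t)`.

Proof.  `λ_n = lim_{T'} Re ∑_{ρ ∈ liZeroBox T'} m(ρ)(1 − (1 − 1/ρ)ⁿ)` (`keiperLiCoeff_eq_zero_sum_holds`).  For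
`T' ≥ T` symmetrise the box sum under the reflection `ρ ↦ 1 − ρ̄` (which preserves the box and the
multiplicities) as in `KeiperLiPositivityUpTo`: twice the sum is `∑_ρ m(ρ)[(1 − Re wⁿ) + (1 − Re w'ⁿ)]`,
`w = 1 − 1/ρ`, `w' = 1 − 1/(1 − ρ̄)`.
* ON THE LINE (`|Im ρ| ≤ T`, so `Re ρ = ½` and `1 − ρ̄ = ρ`): `w = e^{iθ(γ)}` exactly, so the pair term is
  `2 m (1 − cos nθ(γ)) ≥ 0` (`re_one_sub_pow_onLine`, L1); keep only the window `T₂/2 < Im ρ ≤ T₂` and its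
  conjugate image (factor `2`).
* FAR PAIRS (`T < |Im ρ| ≤ T'`): with `w = e^{L}`, `L = log(1 − 1/ρ) = −1/ρ + E`, `‖E‖ ≤ (2/3)/|ρ|²`, one has
  `w' = conj e^{−L}`, so the pair term is `2 − 2 cosh x cos y ≥ 2 − 2 cosh x`, `x = n Re L`, `|x| ≤ (5/3)n/|ρ|²
  ≤ 5/12`; the Taylor bound `2(cosh x − 1) ≤ 1.0146 x²` (`Real.exp_bound` to order 6) gives `≥ −2.82 n²/|ρ|⁴ ≥
  −2.82 n² m/γ⁴` (`far_pair_lower`, L2); the far zeros with `Im ρ < 0` are the conjugates of `zerosBetween T T'`.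
RH-free inputs only: the reflection/conjugation symmetries of the zero set and `RiemannHypothesisUpTo T`.

RH-FREE [rh-li-prover]: the only hypothesis is the FINITE verified height `RiemannHypothesisUpTo T`; the zeros above `T`
enter through proved symmetries of the zero set (conjugation, `ρ ↦ 1 − ρ̄`) and the far-pair inequality.  Part of the
PROOF-OF-DATA rung L-P(P1) of the RH ladder's column LI; nothing here bears on the truth of RH.
-/

noncomputable section

-- D-0017: `Summit.<S>.<S>.…` is the designed namespace of a single-problem summit.
set_option linter.dupNamespace false

open Complex Filter Set
open scoped Real ComplexConjugate Topology

namespace Summit.RiemannHypothesis.RiemannHypothesis.Theorems.LiTheory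

open Literature.NumberTheory.LFunctions Literature.NumberTheory.LFunctions.SchoenfeldBound
open Literature.NumberTheory.DiophantineGeometry

namespace BoxSplit

/-! ### L1 — the on-line term -/

/-- For `ρ = ½ + iγ`, `γ ≠ 0`: `1 − 1/ρ = e^{iθ(γ)}` with `θ(γ) = 2 arctan(1/2γ)`
(`cos θ = (4γ² − 1)/(4γ² + 1)`, `sin θ = 4γ/(4γ² + 1)`). -/
theorem one_sub_inv_eq_exp {ρ : ℂ} (hre : ρ.re = 1 / 2) (him : ρ.im ≠ 0) :
    1 - 1 / ρ = Complex.exp (liZeroAngle ρ.im * I) := by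
  set γ := ρ.im with hγ
  set u : ℝ := 1 / (2 * γ) with hu
  have hρ : ρ = ⟨1 / 2, γ⟩ := Complex.ext hre rfl
  have hns : Complex.normSq ρ = 1 / 4 + γ ^ 2 := by
    rw [hρ, Complex.normSq_mk]; ring
  have hns0 : (1 / 4 + γ ^ 2 : ℝ) ≠ 0 := by positivity
  have h1u : 1 + u ^ 2 = (4 * γ ^ 2 + 1) / (4 * γ ^ 2) := by
    rw [hu]; field_simp; ring
  have hsq : Real.sqrt (1 + u ^ 2) ^ 2 = 1 + u ^ 2 := Real.sq_sqrt (by positivity)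
  have hsqrt0 : Real.sqrt (1 + u ^ 2) ≠ 0 := by positivity
  have hcos : Real.cos (liZeroAngle γ) = (4 * γ ^ 2 - 1) / (4 * γ ^ 2 + 1) := by
    rw [liZeroAngle, Real.cos_two_mul, Real.cos_sq_arctan, ← hu, h1u]
    have : (4 : ℝ) * γ ^ 2 + 1 ≠ 0 := by positivity
    field_simp
    ring
  have hsin : Real.sin (liZeroAngle γ) = 4 * γ / (4 * γ ^ 2 + 1) := by
    rw [liZeroAngle, Real.sin_two_mul, Real.sin_arctan, Real.cos_arctan, ← hu]
    have e : 2 * (u / Real.sqrt (1 + u ^ 2)) * (1 / Real.sqrt (1 + u ^ 2)) =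
        2 * u / Real.sqrt (1 + u ^ 2) ^ 2 := by
      field_simp
    rw [e, hsq, h1u, hu]
    have : (4 : ℝ) * γ ^ 2 + 1 ≠ 0 := by positivity
    field_simp
  apply Complex.ext
  · rw [Complex.exp_ofReal_mul_I_re, hcos, Complex.sub_re, Complex.one_re, one_div, Complex.inv_re, hns,
      hre]
    field_simp
    ring
  · rw [Complex.exp_ofReal_mul_I_im, hsin, Complex.sub_im, Complex.one_im, one_div, Complex.inv_im, hns]
    field_simp
    ring

/-- **L1 (on-line term).**  On the critical line the Li term is the window weight:
`Re(1 − (1 − 1/ρ)ⁿ) = 1 − cos(n θ(Im ρ)) = f_n(Im ρ)` for `Re ρ = ½`, `Im ρ ≠ 0`. -/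
theorem re_one_sub_pow_onLine (n : ℕ) {ρ : ℂ} (hre : ρ.re = 1 / 2) (him : ρ.im ≠ 0) :
    (1 - (1 - 1 / ρ) ^ n).re = liWindowWeight n ρ.im := by
  rw [one_sub_inv_eq_exp hre him, ← Complex.exp_nat_mul, Complex.sub_re, Complex.one_re]
  have e : (n : ℂ) * (↑(liZeroAngle ρ.im) * I) = ↑((n : ℝ) * liZeroAngle ρ.im) * I := by
    push_cast; ring
  rw [e, Complex.exp_ofReal_mul_I_re, liWindowWeight]

/-! ### L2 — the far pair -/

/-- `2(cosh x − 1) ≤ 1.0146 x²` for `|x| ≤ 5/12` (Taylor to order 6, `Real.exp_bound`). -/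
theorem two_mul_cosh_sub_one_le {x : ℝ} (hx : |x| ≤ 5 / 12) :
    2 * (Real.cosh x - 1) ≤ 1.0146 * x ^ 2 := by
  have hx1 : |x| ≤ 1 := hx.trans (by norm_num)
  have hx1' : |-x| ≤ 1 := by rwa [abs_neg]
  have h1 := (abs_le.1 (Real.exp_bound hx1 (n := 6) (by norm_num))).2
  have h2 := (abs_le.1 (Real.exp_bound hx1' (n := 6) (by norm_num))).2
  simp only [Finset.sum_range_succ, Finset.sum_range_zero, Nat.factorial, abs_neg] at h1 h2
  norm_num at h1 h2
  rw [Real.cosh_eq]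
  have hx2 : x ^ 2 ≤ 25 / 144 := by
    have h : |x| ^ 2 ≤ (5 / 12) ^ 2 := pow_le_pow_left₀ (abs_nonneg x) hx 2
    rw [sq_abs] at h
    linarith
  have hx6 : |x| ^ 6 = (x ^ 2) ^ 3 := by
    rw [show (6 : ℕ) = 2 * 3 by norm_num, pow_mul, sq_abs]
  rw [hx6] at h1 h2
  have hx4 : (x ^ 2) ^ 2 ≤ 25 / 144 * x ^ 2 := by nlinarith [sq_nonneg x]
  have hx6' : (x ^ 2) ^ 3 ≤ (25 / 144) ^ 2 * x ^ 2 := by nlinarith [sq_nonneg x]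
  nlinarith [sq_nonneg x]

-- adapted from Literature/NumberTheory/LFunctions/KeiperLiPositivityUpTo.lean (private there)
/-- `1 − 1/(1 − z) = (1 − z⁻¹)⁻¹` for `z ≠ 0, 1`. -/
theorem one_sub_one_div_one_sub_eq {z : ℂ} (hz0 : z ≠ 0) (hz1 : z ≠ 1) :
    1 - 1 / (1 - z) = (1 - z⁻¹)⁻¹ := by
  have h1 : (1 : ℂ) - z ≠ 0 := sub_ne_zero.2 (Ne.symm hz1)
  have h2 : z - 1 ≠ 0 := sub_ne_zero.2 hz1
  rw [show (1 : ℂ) - z⁻¹ = (z - 1) / z by field_simp, inv_div]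
  field_simp
  ring

/-- **L2 (far pair lower bound).**  For `0 ≤ Re ρ ≤ 1`, `|ρ| ≥ 4` and `n ≤ |ρ|²/4`, the pair `{ρ, 1 − ρ̄}`
contributes `Re(1 − (1 − 1/ρ)ⁿ) + Re(1 − (1 − 1/(1 − ρ̄))ⁿ) ≥ −2.82 n²/|ρ|⁴`: with `L = log(1 − 1/ρ)`,
`x + iy = nL`, the left side is `2 − 2 cosh x cos y ≥ 2 − 2 cosh x`, and `|x| ≤ (5/3) n/|ρ|² ≤ 5/12`
(`L = −1/ρ + E`, `‖E‖ ≤ (2/3)/|ρ|²`, `Complex.norm_log_one_add_sub_self_le`). -/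
theorem far_pair_lower (n : ℕ) {ρ : ℂ} (h0 : 0 ≤ ρ.re) (h1 : ρ.re ≤ 1) (h4 : 4 ≤ ‖ρ‖)
    (hn : (n : ℝ) ≤ ‖ρ‖ ^ 2 / 4) :
    -(2.82 * (n : ℝ) ^ 2 / ‖ρ‖ ^ 4) ≤
      (1 - (1 - 1 / ρ) ^ n).re + (1 - (1 - 1 / (1 - conj ρ)) ^ n).re := by
  have hnorm_pos : 0 < ‖ρ‖ := by linarith
  have hρ0 : ρ ≠ 0 := norm_pos_iff.1 hnorm_pos
  have hρ1 : ρ ≠ 1 := by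
    intro h; rw [h, norm_one] at h4; norm_num at h4
  -- the norm square `N = |ρ|²`
  obtain ⟨N, hN⟩ : ∃ N : ℝ, Complex.normSq ρ = N := ⟨_, rfl⟩
  have hNeq' : N = ‖ρ‖ ^ 2 := by rw [← hN, Complex.normSq_eq_norm_sq]
  have hN16 : 16 ≤ N := by rw [hNeq']; nlinarith
  have hNpos : 0 < N := by linarith
  -- `ε = ρ⁻¹`
  have hεsq : ‖ρ⁻¹‖ ^ 2 = N⁻¹ := by rw [Complex.sq_norm, Complex.normSq_inv, hN]
  have hε2le : ‖ρ⁻¹‖ ^ 2 ≤ 1 / 16 := by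
    rw [hεsq, one_div, inv_le_inv₀ hNpos (by norm_num)]
    exact hN16
  have hεle : ‖ρ⁻¹‖ ≤ 1 / 4 := by nlinarith [norm_nonneg ρ⁻¹]
  have hεlt1 : ‖ρ⁻¹‖ < 1 := by linarith
  have hw0 : (1 : ℂ) - ρ⁻¹ ≠ 0 := by
    intro h
    have h' : ‖(ρ⁻¹ : ℂ)‖ = 1 := by rw [← sub_eq_zero.1 h]; simp
    linarith
  obtain ⟨L, hL⟩ : ∃ L : ℂ, Complex.log (1 - ρ⁻¹) = L := ⟨_, rfl⟩
  have hexpL : Complex.exp L = 1 - ρ⁻¹ := by rw [← hL]; exact Complex.exp_log hw0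
  have hwn : (1 - 1 / ρ) ^ n = Complex.exp (n * L) := by
    rw [Complex.exp_nat_mul, hexpL, one_div]
  have hc0 : conj ρ ≠ 0 := fun h ↦ hρ0 (by simpa using congrArg conj h)
  have hc1 : conj ρ ≠ 1 := fun h ↦ hρ1 (by simpa using congrArg conj h)
  have hw'n : (1 - 1 / (1 - conj ρ)) ^ n = conj (Complex.exp (-(n * L))) := by
    rw [Complex.exp_neg, Complex.exp_nat_mul, hexpL, map_inv₀, map_pow, map_sub, map_one,
      map_inv₀, ← inv_pow, one_sub_one_div_one_sub_eq hc0 hc1]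
  have hnL_re : ((n : ℂ) * L).re = n * L.re := by simp [Complex.mul_re]
  have hnL_im : ((n : ℂ) * L).im = n * L.im := by simp [Complex.mul_im]
  have hre1 : ((1 - 1 / ρ) ^ n).re = Real.exp (n * L.re) * Real.cos (n * L.im) := by
    rw [hwn, Complex.exp_re, hnL_re, hnL_im]
  have hre2 : ((1 - 1 / (1 - conj ρ)) ^ n).re =
      Real.exp (-(n * L.re)) * Real.cos (n * L.im) := by
    rw [hw'n, Complex.conj_re, Complex.exp_re, Complex.neg_re, Complex.neg_im, hnL_re, hnL_im,
      Real.cos_neg]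
  rw [Complex.sub_re, Complex.sub_re, Complex.one_re, hre1, hre2]
  obtain ⟨x, hx⟩ : ∃ x : ℝ, (n : ℝ) * L.re = x := ⟨_, rfl⟩
  obtain ⟨y, hy⟩ : ∃ y : ℝ, (n : ℝ) * L.im = y := ⟨_, rfl⟩
  rw [hx, hy]
  have hsum : Real.exp x * Real.cos y + Real.exp (-x) * Real.cos y =
      2 * (Real.cosh x * Real.cos y) := by
    rw [Real.cosh_eq]; ring
  -- the logarithm: `L = -ρ⁻¹ + E`, `‖E‖ ≤ (2/3) N⁻¹`
  have hE : ‖L + ρ⁻¹‖ ≤ 2 / 3 * N⁻¹ := by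
    have h := Complex.norm_log_one_add_sub_self_le (z := -ρ⁻¹) (by rwa [norm_neg])
    rw [norm_neg, ← sub_eq_add_neg, hL, sub_neg_eq_add] at h
    have hinv : (1 - ‖(ρ⁻¹ : ℂ)‖)⁻¹ ≤ 4 / 3 := by
      have h43 : (4 / 3 : ℝ)⁻¹ = 3 / 4 := by norm_num
      rw [inv_le_comm₀ (by linarith) (by norm_num), h43]
      linarith
    calc ‖L + ρ⁻¹‖ ≤ ‖(ρ⁻¹ : ℂ)‖ ^ 2 * (1 - ‖(ρ⁻¹ : ℂ)‖)⁻¹ / 2 := h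
      _ ≤ ‖(ρ⁻¹ : ℂ)‖ ^ 2 * (4 / 3) / 2 := by gcongr
      _ = 2 / 3 * N⁻¹ := by rw [hεsq]; ring
  have hLre : |L.re| ≤ 5 / 3 * N⁻¹ := by
    have h1' : |(L + ρ⁻¹).re| ≤ 2 / 3 * N⁻¹ := (Complex.abs_re_le_norm _).trans hE
    rw [Complex.add_re, Complex.inv_re, hN] at h1'
    have h2 : 0 ≤ ρ.re / N := div_nonneg h0 hNpos.le
    have h3 : ρ.re / N ≤ N⁻¹ := by
      rw [div_le_iff₀ hNpos, inv_mul_cancel₀ hNpos.ne']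
      exact h1
    have h4' := abs_le.1 h1'
    rw [abs_le]
    constructor <;> linarith [h4'.1, h4'.2]
  -- `|x| ≤ (5/3) n/N ≤ 5/12`
  have hn0' : (0 : ℝ) ≤ n := n.cast_nonneg
  have hu : (n : ℝ) / N ≤ 1 / 4 := by
    rw [div_le_iff₀ hNpos, hNeq']; linarith
  have hxb : |x| ≤ 5 / 3 * (n / N) := by
    rw [← hx, abs_mul, Nat.abs_cast]
    calc (n : ℝ) * |L.re| ≤ n * (5 / 3 * N⁻¹) := mul_le_mul_of_nonneg_left hLre hn0'
      _ = 5 / 3 * (n / N) := by ring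
  have hx512 : |x| ≤ 5 / 12 := hxb.trans (by linarith)
  have hcosh := two_mul_cosh_sub_one_le hx512
  -- `cosh x cos y ≤ cosh x`
  have hcc : Real.cosh x * Real.cos y ≤ Real.cosh x :=
    (mul_le_mul_of_nonneg_left (Real.cos_le_one y) (Real.cosh_pos x).le).trans_eq (mul_one _)
  -- `x² ≤ (25/9)(n/N)²` and `(n/N)² = n²/‖ρ‖⁴`
  have hx2 : x ^ 2 ≤ 25 / 9 * ((n : ℝ) / N) ^ 2 := by
    have h := pow_le_pow_left₀ (abs_nonneg x) hxb 2
    rw [sq_abs] at h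
    nlinarith
  have hfrac : ((n : ℝ) / N) ^ 2 = (n : ℝ) ^ 2 / ‖ρ‖ ^ 4 := by
    rw [hNeq', div_pow, ← pow_mul]
  rw [hfrac] at hx2
  have hpos : 0 ≤ (n : ℝ) ^ 2 / ‖ρ‖ ^ 4 := by positivity
  have hq : 2.82 * (n : ℝ) ^ 2 / ‖ρ‖ ^ 4 = 2.82 * ((n : ℝ) ^ 2 / ‖ρ‖ ^ 4) := by ring
  rw [hq]
  linarith [hsum, hcc, hcosh, hx2, hpos]

/-! ### The box bookkeeping -/

-- adapted from Literature/NumberTheory/LFunctions/KeiperLiPositivityUpTo.lean (private there)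
/-- Two-sided form of `RiemannHypothesisUpTo T`: a zero `s` with `0 < |Im s| ≤ T` has `Re s = 1/2`. -/
theorem re_eq_half_of_riemannHypothesisUpTo {T : ℝ} (hRH : RiemannHypothesisUpTo T)
    {s : ℂ} (hs : riemannZeta s = 0) (him : s.im ≠ 0) (hT : |s.im| ≤ T) : s.re = 1 / 2 := by
  rcases lt_or_gt_of_ne him with hneg | hpos
  · have hs' : riemannZeta (conj s) = 0 := by rw [riemannZeta_conj, hs, map_zero]
    have h := hRH (conj s) hs' (by simpa using hneg)
      (by rw [Complex.conj_im, ← abs_of_neg hneg]; exact hT)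
    simpa using h
  · exact hRH s hs hpos (by rwa [abs_of_pos hpos] at hT)

-- adapted from Literature/NumberTheory/LFunctions/KeiperLiPositivityUpTo.lean (private there)
/-- The boxes `liZeroBox T` are stable under the reflection `ρ ↦ 1 − ρ̄`. -/
theorem one_sub_conj_mem_liZeroBox {T : ℝ} {ρ : ℂ} (hρ : ρ ∈ liZeroBox T) :
    1 - conj ρ ∈ liZeroBox T := by
  obtain ⟨hz, h0, h1, him, hT⟩ := hρ
  have him0 : ρ.im ≠ 0 := abs_pos.1 him
  have hρ1 : ρ ≠ 1 := fun h ↦ him0 (by simp [h])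
  have hre_pos : 0 < ρ.re := re_pos_of_riemannZeta_eq_zero hz him0
  have hre_lt : ρ.re < 1 :=
    lt_of_le_of_ne h1 fun h ↦ riemannZeta_ne_zero_of_one_le_re (le_of_eq h.symm) hz
  have h1' : (1 : ℂ) - conj ρ ≠ 1 := by
    intro h
    apply him0
    have h' := congrArg Complex.im h
    simpa using h'
  have hm : 0 < riemannZetaZeroOrder (1 - conj ρ) := by
    rw [riemannZetaZeroOrder_one_sub_conj hre_pos hre_lt]
    exact (riemannZetaZeroOrder_pos_iff hρ1).2 hz
  refine ⟨(riemannZetaZeroOrder_pos_iff h1').1 hm, ?_, ?_, ?_, ?_⟩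
  · simp only [sub_re, one_re, conj_re]; linarith
  · simp only [sub_re, one_re, conj_re]; linarith
  · simpa using him
  · simpa using hT

/-- The window weight is even in `t`. -/
theorem liWindowWeight_neg (n : ℕ) (t : ℝ) : liWindowWeight n (-t) = liWindowWeight n t := by
  simp only [liWindowWeight, liZeroAngle, mul_neg, div_neg, Real.arctan_neg, Real.cos_neg]

/-- Conjugates of zeros between two positive heights lie in the box and below `T`. -/
theorem conj_mem_of_mem_zerosBetween {a b T' : ℝ} (ha : 0 ≤ a) (hb : b ≤ T') {ρ : ℂ}
    (hρ : ρ ∈ zerosBetween a b) : conj ρ ∈ liZeroBox T' ∧ |(conj ρ).im| = ρ.im := by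
  obtain ⟨hz, h0, h1, h3, h4⟩ := (mem_zerosBetween ha).1 hρ
  have hpos : 0 < ρ.im := lt_of_le_of_lt ha h3
  have habs : |(conj ρ).im| = ρ.im := by
    rw [Complex.conj_im, abs_neg, abs_of_pos hpos]
  refine ⟨⟨by rw [riemannZeta_conj, hz, map_zero], by simpa using h0, by simpa using h1, ?_, ?_⟩, habs⟩
  · rw [habs]; exact hpos
  · rw [habs]; linarith

end BoxSplit

end Summit.RiemannHypothesis.RiemannHypothesis.Theorems.LiTheory

end
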